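import Literature.Geometry.Kaehler.ComplexTorusHodgeGroupProductSemisimple
import Literature.Geometry.Kaehler.ComplexTorusHodgeGroupSigmaPiProjectionsSurjective
import HarnessLib

/-!
# `Hg(∏ₖ X_k)` is semisimple iff every `Hg(X_k)` is: the commutator subgroup and the radical of the Hodge group of a
# finite product of complex tori of arbitrary dimensions versus the factors (Moonen–Zarhin (3.1) with the surjective
# projections of g37-#3), and Gordon's lemma `Hg((∏ₖ X_k) × Y) = Hg(∏ₖ X_k) × Hg(Y)` for perfect `Hg(X_k)`, commutative `Hg(Y)`

Layer `Literature/Geometry/Kaehler`, namespace `Literature.Geometry.Kaehler.ComplexTorus`; lane `lit-hodgefound`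
(Track 2 foundations library), Layer A3; prover seat `lit-hodgefound-p17` (generation 37, self-proposed row g37-#8, the
finite-family form of g37-#6/#7 (`ComplexTorusHodgeGroupProductDerivedSeries`, `ComplexTorusHodgeGroupProductSemisimple`),
through g37-#3 `ComplexTorusHodgeGroupSigmaPiProjectionsSurjective` (the `k`-th block `pr_k : Hg(∏ₖ X_k)(ℂ) → Hg(X_k)(ℂ)`
is an ALGEBRAIC homomorphism and is ONTO). THEOREMS ONLY (no definition, no instance, no notation, no named fact; D-0026
net debt 0). The product torus is p10's dependent product `sigmaPiPeriod Ψ` of a family `Ψ : ∀ k, (σ k → ℝ) ≃L[ℝ] F k`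
indexed by a `Fintype κ`; block-diagonal elements are p36's `sigmaBlockDiagSL σ ℂ A`, `sigmaBlockDiagGL σ ℂ A`.

## Sources, verbatim

* B. Moonen, Yu. G. Zarhin [MoonenZarhin1999LowDim], held `paper:arxiv-math_9901113`, §3 (3.1) (p0006 L25–L28):
  "`Hg(X₁ × X₂)` is an algebraic subgroup of `Hg(X₁) × Hg(X₂)`; the two projections are surjective" (any finite number
  of factors by induction); §1: "If `X` has no factors of Type IV then `Hg(X)` is semi-simple"; §3 Theorem (2).
* B. B. Gordon [Gordon1997], held `paper:arxiv-alg-geom_9709030`, §2.9 Proposition, §2.5.2 Corollary, §3 Theorem, proof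
  (p0014 L33–L37: "`Hg(A) = Hg(B) × Hg(C)`" for `Hg(B)` a torus and `Hg(C)` semisimple).
* T. A. Springer, *Linear Algebraic Groups* (1998) [Springer1998], 2.2.5 (ii), (iv); 6.4.14; 8.1.5 (ii).
* H. Imai [Imai1976HodgeGroups], §1 (p. 367), §2 Proposition (p. 370: "`q([H, H]) = [q(H), q(H)]`").

## What is proved (every finite family of complex tori unless "polarised" is said)

* §1 COMMUTATORS: **`commutator_hodgeGroupC_sigmaPi_le`** (`(Hg(∏ₖ X_k), Hg(∏ₖ X_k))(ℂ) ≤ ∏ₖ (Hg(X_k), Hg(X_k))(ℂ)`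
  block-diagonally), `apply_mem_commutator_of_sigmaBlockDiagSL_mem_commutator`,
  **`exists_sigmaBlockDiagSL_mem_commutator_apply_eq`** (every element of `(Hg(X_k), Hg(X_k))` is the `k`-th block of
  an element of `(Hg(∏), Hg(∏))` — Imai's "`q([H, H]) = [q(H), q(H)]`"), **`commutator_hodgeGroupC_eq_self_of_sigmaPi`**
  (`Hg(∏ₖ X_k)(ℂ)` perfect ⟹ every `Hg(X_k)(ℂ)` perfect), **`commutator_hodgeGroupC_sigmaPi_eq_bot_iff`** (`(Hg, Hg) = 1`
  for the product iff for every factor; the commutator-subgroup form of p10's `hodgeGroupC_sigmaPi_comm_iff`).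
* §2 RADICAL: **`map_sigmaBlock_radical_le_radical`** (`pr_k(R(Hg(∏ₖ X_k)(ℂ))) ≤ R(Hg(X_k)(ℂ))`, Springer 2.2.5 +
  6.4.14), **`radical_map_toGL_hodgeGroupC_sigmaPi_eq_bot`** (`∀ k, R(Hg(X_k)) = 1 ⟹ R(Hg(∏ₖ X_k)) = 1`).
* §3 POLARISED FAMILIES: **`IsRiemannForm.radical_map_toGL_hodgeGroupC_sigmaPi_eq_bot_iff`** and
  **`IsRiemannForm.commutator_hodgeGroupC_sigmaPi_eq_self_iff`** (`Hg(∏ₖ X_k)` semisimple ∕ perfect ⟺ every `Hg(X_k)`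
  is), `IsRiemannForm.commutator_hodgeGroupC_sigmaPi_eq_self`, the arithmetic inputs `…_of_forall_rosati_eq` (no factor
  of Type IV anywhere) and `…_of_endAlgRat_eq_bot` (`End_ℚ(X_k) = ℚ` for all `k`).
* §4 GORDON'S LEMMA FOR `(∏ₖ X_k) × Y`: **`IsRiemannForm.hodgeGroupC_sigmaPi_prod_eq_blockDiagProd_of_commutator_eq`**
  (`Hg((∏ₖ X_k) × Y)(ℂ) = Hg(∏ₖ X_k)(ℂ) × Hg(Y)(ℂ)` for polarised `X_k` with perfect `Hg(X_k)(ℂ)` and commutative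
  `Hg(Y)(ℂ)`), real points, the locus case `Y = ∏ₗ Z_l` (`…_sigmaPi_prod_sigmaPiPeriod_…_of_coe_eq_range`), and the
  stable-nondegeneracy transfer `IsRiemannForm.forall_divisorClasses_powPeriod_sigmaPi_prod_eq_hodgeClasses_of_commutator_eq`.

NOT here: the structure of `Hg(∏ₖ X_k)` itself for several semisimple factors (Lie-algebra Goursat).

## References

* [MoonenZarhin1999LowDim] B. Moonen, Yu. G. Zarhin, Math. Ann. 315 (1999), §1, §3 (3.1), §3 Theorem (2).
* [Gordon1997] B. B. Gordon, *A survey of the Hodge conjecture for abelian varieties* (alg-geom/9709030), §2.5.2, §2.9, §3.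
* [Springer1998] T. A. Springer, *Linear Algebraic Groups*, 2nd ed. (1998), 2.2.5, 6.4.14, 8.1.5.
* [Imai1976HodgeGroups] H. Imai, Kodai Math. Sem. Rep. 27 (1976), §1–§2.
-/

noncomputable section

open Matrix Module
open scoped MatrixGroups

namespace Literature.Geometry.Kaehler

namespace ComplexTorus

open Literature.NumberTheory.Automorphic

variable {κ : Type*} [Fintype κ] [DecidableEq κ] {σ : κ → Type*} [∀ k, Fintype (σ k)] [∀ k, DecidableEq (σ k)]
  {F : κ → Type*} [∀ k, NormedAddCommGroup (F k)] [∀ k, NormedSpace ℂ (F k)] (Ψ : ∀ k, (σ k → ℝ) ≃L[ℝ] F k)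

/-! ## §1 The commutator subgroup of `Hg(∏ₖ X_k)(ℂ)` versus the factors -/

section Commutator

/-- **`(Hg(∏ₖ X_k), Hg(∏ₖ X_k))(ℂ) ≤ diag(∏ₖ (Hg(X_k), Hg(X_k))(ℂ))`** (`Hg(∏) ⊂ ∏ Hg(X_k)` and the commutator of a
product of subgroups lies in the product of the commutators). [cite: Imai1976HodgeGroups, §1 (p. 367) and §2 Proposition (p. 370)]
[cite: MoonenZarhin1999LowDim, §3 (3.1)] -/
theorem commutator_hodgeGroupC_sigmaPi_le :
    ⁅hodgeGroupC (sigmaPiPeriod Ψ), hodgeGroupC (sigmaPiPeriod Ψ)⁆ ≤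
      (Subgroup.pi Set.univ fun k ↦ ⁅hodgeGroupC (Ψ k), hodgeGroupC (Ψ k)⁆).map (sigmaBlockDiagSL σ ℂ) := by
  refine (Subgroup.commutator_mono (hodgeGroupC_sigmaPi_le Ψ) (hodgeGroupC_sigmaPi_le Ψ)).trans ?_
  rw [← Subgroup.map_commutator]
  exact Subgroup.map_mono (Subgroup.commutator_pi_pi_le _ _)

/-- The blocks of an element of `(Hg(∏ₖ X_k), Hg(∏ₖ X_k))(ℂ)` lie in the `(Hg(X_k), Hg(X_k))(ℂ)`.
[cite: Imai1976HodgeGroups, §2 Proposition (p. 370)] -/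
theorem apply_mem_commutator_of_sigmaBlockDiagSL_mem_commutator {A : ∀ k, SpecialLinearGroup (σ k) ℂ}
    (h : sigmaBlockDiagSL σ ℂ A ∈ ⁅hodgeGroupC (sigmaPiPeriod Ψ), hodgeGroupC (sigmaPiPeriod Ψ)⁆) (k : κ) :
    A k ∈ ⁅hodgeGroupC (Ψ k), hodgeGroupC (Ψ k)⁆ := by
  obtain ⟨B, hB, hBA⟩ := Subgroup.mem_map.1 (commutator_hodgeGroupC_sigmaPi_le Ψ h)
  obtain rfl : B = A := sigmaBlockDiagSL_injective hBA
  exact (Subgroup.mem_pi _).1 hB k (Set.mem_univ k)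

/-- **Every `g ∈ (Hg(X_k), Hg(X_k))(ℂ)` is the `k`-th block of some `diag(A_l)_l ∈ (Hg(∏ₖ X_k), Hg(∏ₖ X_k))(ℂ)`** with
all `A_l ∈ (Hg(X_l), Hg(X_l))(ℂ)` (Imai's "`q([H, H]) = [q(H), q(H)]`": closure induction on commutators, the lifts
provided by g37-#3's surjectivity). [cite: Imai1976HodgeGroups, §2 Proposition (p. 370)] [cite: MoonenZarhin1999LowDim, §3 (3.1)] -/
theorem exists_sigmaBlockDiagSL_mem_commutator_apply_eq (k : κ) {g : SpecialLinearGroup (σ k) ℂ}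
    (hg : g ∈ ⁅hodgeGroupC (Ψ k), hodgeGroupC (Ψ k)⁆) :
    ∃ A : ∀ l, SpecialLinearGroup (σ l) ℂ,
      sigmaBlockDiagSL σ ℂ A ∈ ⁅hodgeGroupC (sigmaPiPeriod Ψ), hodgeGroupC (sigmaPiPeriod Ψ)⁆ ∧ A k = g := by
  rw [Subgroup.commutator_def] at hg
  refine Subgroup.closure_induction (p := fun g _ ↦ ∃ A : ∀ l, SpecialLinearGroup (σ l) ℂ,
    sigmaBlockDiagSL σ ℂ A ∈ ⁅hodgeGroupC (sigmaPiPeriod Ψ), hodgeGroupC (sigmaPiPeriod Ψ)⁆ ∧ A k = g) ?_ ?_ ?_ ?_ hg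
  · rintro _ ⟨a, ha, b, hb, rfl⟩
    obtain ⟨A, hA, hAk, -⟩ := exists_sigmaBlockDiagSL_mem_hodgeGroupC_sigmaPi_apply_eq Ψ k ha
    obtain ⟨B, hB, hBk, -⟩ := exists_sigmaBlockDiagSL_mem_hodgeGroupC_sigmaPi_apply_eq Ψ k hb
    refine ⟨A * B * A⁻¹ * B⁻¹, ?_, ?_⟩
    · rw [map_mul, map_mul, map_mul, map_inv, map_inv]
      exact Subgroup.commutator_mem_commutator hA hB
    · rw [commutatorElement_def, ← hAk, ← hBk]
      rfl
  · exact ⟨1, by rw [map_one]; exact one_mem _, rfl⟩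
  · rintro x y _ _ ⟨A, hA, rfl⟩ ⟨B, hB, rfl⟩
    exact ⟨A * B, by rw [map_mul]; exact mul_mem hA hB, rfl⟩
  · rintro x _ ⟨A, hA, rfl⟩
    exact ⟨A⁻¹, by rw [map_inv]; exact inv_mem hA, rfl⟩

/-- **`Hg(∏ₖ X_k)(ℂ)` perfect ⟹ every `Hg(X_k)(ℂ)` perfect** (the `k`-th block of `Hg(∏) = (Hg(∏), Hg(∏))` lies in
`(Hg(X_k), Hg(X_k))`, and `pr_k` is onto). [cite: Imai1976HodgeGroups, §2 Proposition (p. 370)] [cite: Gordon1997, §2.5.2 Corollary] -/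
theorem commutator_hodgeGroupC_eq_self_of_sigmaPi
    (h : ⁅hodgeGroupC (sigmaPiPeriod Ψ), hodgeGroupC (sigmaPiPeriod Ψ)⁆ = hodgeGroupC (sigmaPiPeriod Ψ)) (k : κ) :
    ⁅hodgeGroupC (Ψ k), hodgeGroupC (Ψ k)⁆ = hodgeGroupC (Ψ k) := by
  refine le_antisymm (Subgroup.commutator_le_self _) fun g hg ↦ ?_
  obtain ⟨A, hA, hAk, -⟩ := exists_sigmaBlockDiagSL_mem_hodgeGroupC_sigmaPi_apply_eq Ψ k hg
  rw [← h] at hA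
  rw [← hAk]
  exact apply_mem_commutator_of_sigmaBlockDiagSL_mem_commutator Ψ hA k

/-- **`(Hg(∏ₖ X_k), Hg(∏ₖ X_k))(ℂ) = 1 ⟺ (Hg(X_k), Hg(X_k))(ℂ) = 1` for every `k`** — the commutator-subgroup form of
p10's `hodgeGroupC_sigmaPi_comm_iff` ("a product is of CM-type iff every factor is").
[cite: MoonenZarhin1999LowDim, §3 (3.1) and §1] [cite: Gordon1997, §2.12 Proposition] -/
theorem commutator_hodgeGroupC_sigmaPi_eq_bot_iff :
    ⁅hodgeGroupC (sigmaPiPeriod Ψ), hodgeGroupC (sigmaPiPeriod Ψ)⁆ = ⊥ ↔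
      ∀ k, ⁅hodgeGroupC (Ψ k), hodgeGroupC (Ψ k)⁆ = ⊥ := by
  rw [commutator_hodgeGroupC_eq_bot_iff_forall_comm, hodgeGroupC_sigmaPi_comm_iff]
  exact forall_congr' fun k ↦ (commutator_hodgeGroupC_eq_bot_iff_forall_comm (Ψ k)).symm

end Commutator

/-! ## §2 The radical of `Hg(∏ₖ X_k)(ℂ)` projects into the radicals of the factors -/

section Radical

/-- **`pr_k(R(Hg(∏ₖ X_k)(ℂ))) ≤ R(Hg(X_k)(ℂ))`**: the image of the radical under the algebraic surjection `pr_k` (g37-#3)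
is Zariski-connected (Springer 2.2.5), solvable and normal in `Hg(X_k)(ℂ)`, hence inside the radical (6.4.14).
[cite: Springer1998, 2.2.5 (ii), (iv) and 6.4.14] [cite: MoonenZarhin1999LowDim, §3 (3.1)] -/
theorem map_sigmaBlock_radical_le_radical (k : κ) :
    (((radical ((hodgeGroupC (sigmaPiPeriod Ψ)).map Matrix.SpecialLinearGroup.toGL)).subgroupOf
        ((hodgeGroupC (sigmaPiPeriod Ψ)).map Matrix.SpecialLinearGroup.toGL)).map
      ((Pi.evalMonoidHom (fun l ↦ GL (σ l) ℂ) k).comp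
        ((MonoidHom.ofInjective (sigmaBlockDiagGL_injective (σ := σ) (R := ℂ))).symm.toMonoidHom.comp
          (Subgroup.inclusion (map_toGL_hodgeGroupC_sigmaPi_le_range Ψ))))) ≤
      radical ((hodgeGroupC (Ψ k)).map Matrix.SpecialLinearGroup.toGL) := by
  set G := (hodgeGroupC (sigmaPiPeriod Ψ)).map Matrix.SpecialLinearGroup.toGL with hG
  set f := (Pi.evalMonoidHom (fun l ↦ GL (σ l) ℂ) k).comp
    ((MonoidHom.ofInjective (sigmaBlockDiagGL_injective (σ := σ) (R := ℂ))).symm.toMonoidHom.comp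
      (Subgroup.inclusion (map_toGL_hodgeGroupC_sigmaPi_le_range Ψ))) with hf
  have hrange : f.range = (hodgeGroupC (Ψ k)).map Matrix.SpecialLinearGroup.toGL := by
    rw [hf, range_sigmaBlock_hodgeGroupC_eq, hodgeGroupCSigmaPiProj_eq_hodgeGroupC]
  have hle : ((radical G).subgroupOf G).map f ≤ (hodgeGroupC (Ψ k)).map Matrix.SpecialLinearGroup.toGL := by
    rw [← hrange]
    exact Subgroup.map_le_range f _
  have hconn : IsZConnected (((radical G).subgroupOf G).map f) :=
    (isAlgebraicGL_sigmaBlock k _).isZConnected_map_of_le (isZConnected_radical G) (radical_le G)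
  have hsolvR : IsSolvable ↥((radical G).subgroupOf G) := by
    haveI := isSolvable_radical G
    exact solvable_of_solvable_injective (f := (Subgroup.subgroupOfEquivOfLe (radical_le G)).toMonoidHom)
      (MulEquiv.injective _)
  have hsolv : IsSolvable ↥(((radical G).subgroupOf G).map f) := by
    haveI := hsolvR
    exact solvable_of_surjective (MonoidHom.subgroupMap_surjective f _)
  have hnormal : ((((radical G).subgroupOf G).map f).subgroupOf
      ((hodgeGroupC (Ψ k)).map Matrix.SpecialLinearGroup.toGL)).Normal := by
    refine ⟨fun x hx y ↦ ?_⟩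
    rw [Subgroup.mem_subgroupOf] at hx ⊢
    obtain ⟨r, hr, hxr⟩ := hx
    have hy : (y : GL (σ k) ℂ) ∈ f.range := by
      rw [hrange]
      exact y.2
    obtain ⟨g, hg⟩ := hy
    refine ⟨g * r * g⁻¹, (normal_radical G).conj_mem r hr g, ?_⟩
    rw [map_mul, map_mul, map_inv, hxr, hg, Subgroup.coe_mul, Subgroup.coe_mul, Subgroup.coe_inv]
  exact le_radical hle hnormal hconn hsolv

/-- **`R(Hg(X_k)(ℂ)) = 1` for every `k` ⟹ `R(Hg(∏ₖ X_k)(ℂ)) = 1`** (all blocks of an element of the radical are `1`).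
[cite: Springer1998, 2.2.5 and 6.4.14] [cite: MoonenZarhin1999LowDim, §3 (3.1) and §1] [cite: Gordon1997, §2.9 Proposition] -/
theorem radical_map_toGL_hodgeGroupC_sigmaPi_eq_bot
    (h : ∀ k, radical ((hodgeGroupC (Ψ k)).map Matrix.SpecialLinearGroup.toGL) = ⊥) :
    radical ((hodgeGroupC (sigmaPiPeriod Ψ)).map Matrix.SpecialLinearGroup.toGL) = ⊥ := by
  set G := (hodgeGroupC (sigmaPiPeriod Ψ)).map Matrix.SpecialLinearGroup.toGL with hG
  refine (Subgroup.eq_bot_iff_forall _).2 fun x hx ↦ ?_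
  have hxG : x ∈ G := radical_le G hx
  obtain ⟨A, hAx⟩ := map_toGL_hodgeGroupC_sigmaPi_le_range Ψ hxG
  have hg : (⟨x, hxG⟩ : ↥G) ∈ (radical G).subgroupOf G := by
    rw [Subgroup.mem_subgroupOf]
    exact hx
  have hA : ∀ k, A k = 1 := fun k ↦ by
    have hk := map_sigmaBlock_radical_le_radical Ψ k ⟨⟨x, hxG⟩, hg, rfl⟩
    rw [h k, Subgroup.mem_bot] at hk
    have e := sigmaBlock_apply_sigmaBlockDiagGL k (map_toGL_hodgeGroupC_sigmaPi_le_range Ψ) A (hAx ▸ hxG)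
    have e' : (⟨sigmaBlockDiagGL σ ℂ A, hAx ▸ hxG⟩ : ↥G) = ⟨x, hxG⟩ := Subtype.ext hAx
    rw [e'] at e
    rw [← e, hk]
  have hA1 : A = 1 := funext hA
  rw [← hAx, hA1, map_one]

end Radical

/-! ## §3 Polarised families: `Hg(∏ₖ X_k)` semisimple iff every `Hg(X_k)` is -/

section Polarised

variable {Ψ} {ω : ∀ k, F k [⋀^Fin 2]→L[ℝ] ℝ}

/-- **`Hg(∏ₖ X_k)` IS SEMISIMPLE IFF EVERY `Hg(X_k)` IS** (polarised complex tori; radical form). ⟸ §2 (all families);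
⟹ §1 with "semisimple ⟺ perfect" for the connected reductive Hodge groups (p22) of `X_k` and of the polarised product
(`IsRiemannForm.sigmaPi`). [cite: MoonenZarhin1999LowDim, §1 and §3 (3.1)] [cite: Gordon1997, §2.9 Proposition and §2.5.2 Corollary]
[cite: Springer1998, 6.4.14 and 8.1.5 (ii)] -/
theorem IsRiemannForm.radical_map_toGL_hodgeGroupC_sigmaPi_eq_bot_iff (hω : ∀ k, IsRiemannForm (Ψ k) (ω k)) :
    radical ((hodgeGroupC (sigmaPiPeriod Ψ)).map Matrix.SpecialLinearGroup.toGL) = ⊥ ↔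
      ∀ k, radical ((hodgeGroupC (Ψ k)).map Matrix.SpecialLinearGroup.toGL) = ⊥ := by
  refine ⟨fun h k ↦ ?_, radical_map_toGL_hodgeGroupC_sigmaPi_eq_bot Ψ⟩
  exact (hω k).radical_map_toGL_hodgeGroupC_eq_bot_iff_commutator_eq.2
    (commutator_hodgeGroupC_eq_self_of_sigmaPi Ψ
      ((IsRiemannForm.sigmaPi hω).radical_map_toGL_hodgeGroupC_eq_bot_iff_commutator_eq.1 h) k)

/-- **Perfect form: `(Hg(∏ₖ X_k), Hg(∏ₖ X_k)) = Hg(∏ₖ X_k)` iff `(Hg(X_k), Hg(X_k)) = Hg(X_k)` for every `k`**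
(polarised). [cite: Springer1998, 8.1.5 (ii)] [cite: Gordon1997, §2.5.2 Corollary and §2.9 Proposition] [cite: MoonenZarhin1999LowDim, §1] -/
theorem IsRiemannForm.commutator_hodgeGroupC_sigmaPi_eq_self_iff (hω : ∀ k, IsRiemannForm (Ψ k) (ω k)) :
    ⁅hodgeGroupC (sigmaPiPeriod Ψ), hodgeGroupC (sigmaPiPeriod Ψ)⁆ = hodgeGroupC (sigmaPiPeriod Ψ) ↔
      ∀ k, ⁅hodgeGroupC (Ψ k), hodgeGroupC (Ψ k)⁆ = hodgeGroupC (Ψ k) := by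
  rw [← (IsRiemannForm.sigmaPi hω).radical_map_toGL_hodgeGroupC_eq_bot_iff_commutator_eq,
    IsRiemannForm.radical_map_toGL_hodgeGroupC_sigmaPi_eq_bot_iff hω]
  exact forall_congr' fun k ↦ (hω k).radical_map_toGL_hodgeGroupC_eq_bot_iff_commutator_eq

/-- **Every `Hg(X_k)(ℂ)` perfect ⟹ `Hg(∏ₖ X_k)(ℂ)` perfect** (polarised). [cite: Gordon1997, §2.9 Proposition]
[cite: MoonenZarhin1999LowDim, §1] -/
theorem IsRiemannForm.commutator_hodgeGroupC_sigmaPi_eq_self (hω : ∀ k, IsRiemannForm (Ψ k) (ω k))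
    (h : ∀ k, ⁅hodgeGroupC (Ψ k), hodgeGroupC (Ψ k)⁆ = hodgeGroupC (Ψ k)) :
    ⁅hodgeGroupC (sigmaPiPeriod Ψ), hodgeGroupC (sigmaPiPeriod Ψ)⁆ = hodgeGroupC (sigmaPiPeriod Ψ) :=
  (IsRiemannForm.commutator_hodgeGroupC_sigmaPi_eq_self_iff hω).2 h

/-- **No factor of Type IV anywhere ⟹ `Hg(∏ₖ X_k)(ℂ)` perfect**: every `X_k` polarised with Rosati-fixed centre of
`End_ℚ(X_k)` (p22's criterion per factor). [cite: MoonenZarhin1999LowDim, §1 ("If `X` has no factors of Type IV then `Hg(X)` is semi-simple")]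
[cite: Gordon1997, §2.9 Proposition] -/
theorem IsRiemannForm.commutator_hodgeGroupC_sigmaPi_eq_self_of_forall_rosati_eq (hω : ∀ k, IsRiemannForm (Ψ k) (ω k))
    {G₀ : ∀ k, Matrix (σ k) (σ k) ℚ} (hG₀ : ∀ k, (G₀ k).map (Rat.cast : ℚ → ℝ) = latticeGram (Ψ k) (ω k))
    (htriv : ∀ k, ∀ B ∈ endAlgRat (Ψ k), (∀ C ∈ endAlgRat (Ψ k), B * C = C * B) → rosati (G₀ k) B = B) :
    ⁅hodgeGroupC (sigmaPiPeriod Ψ), hodgeGroupC (sigmaPiPeriod Ψ)⁆ = hodgeGroupC (sigmaPiPeriod Ψ) :=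
  IsRiemannForm.commutator_hodgeGroupC_sigmaPi_eq_self hω fun k ↦
    ((hω k).commutator_hodgeGroupC_eq_self_of_forall_rosati_eq (hG₀ k) (htriv k)).1

/-- **`End_ℚ(X_k) = ℚ` for every `k` ⟹ `Hg(∏ₖ X_k)(ℂ)` perfect** (polarised, `X_k ≠ 0`). [cite: Gordon1997, §2.7 Proposition and §2.5.2 Corollary]
[cite: MoonenZarhin1999LowDim, §1] -/
theorem IsRiemannForm.commutator_hodgeGroupC_sigmaPi_eq_self_of_endAlgRat_eq_bot [∀ k, Nonempty (σ k)]
    (hω : ∀ k, IsRiemannForm (Ψ k) (ω k)) (hE : ∀ k, endAlgRat (Ψ k) = ⊥) :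
    ⁅hodgeGroupC (sigmaPiPeriod Ψ), hodgeGroupC (sigmaPiPeriod Ψ)⁆ = hodgeGroupC (sigmaPiPeriod Ψ) :=
  IsRiemannForm.commutator_hodgeGroupC_sigmaPi_eq_self hω fun k ↦
    ((hω k).commutator_hodgeGroupC_eq_self_of_endAlgRat_eq_bot (hE k)).1

end Polarised

/-! ## §4 Gordon's lemma for `(∏ₖ X_k) × Y` with perfect `Hg(X_k)` and commutative `Hg(Y)` -/

section Gordon

variable {Ψ} {ω : ∀ k, F k [⋀^Fin 2]→L[ℝ] ℝ}
  {ι₂ : Type*} [Fintype ι₂] [DecidableEq ι₂] {E₂ : Type*} [NormedAddCommGroup E₂] [NormedSpace ℂ E₂]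
  (Φ₂ : (ι₂ → ℝ) ≃L[ℝ] E₂)

/-- **`Hg((∏ₖ X_k) × Y)(ℂ) = Hg(∏ₖ X_k)(ℂ) × Hg(Y)(ℂ)`** for polarised `X_k` with perfect `Hg(X_k)(ℂ)` (e.g. no factor of
Type IV) and any torus `Y` with commutative `Hg(Y)(ℂ)` — Gordon's lemma (g37-#2) for the perfect group `Hg(∏ₖ X_k)(ℂ)`
of §3. [cite: Gordon1997, §3 Theorem, proof (p0014 L33–L37)] [cite: MoonenZarhin1999LowDim, §3 Theorem (2)] -/
theorem IsRiemannForm.hodgeGroupC_sigmaPi_prod_eq_blockDiagProd_of_commutator_eq (hω : ∀ k, IsRiemannForm (Ψ k) (ω k))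
    (h : ∀ k, ⁅hodgeGroupC (Ψ k), hodgeGroupC (Ψ k)⁆ = hodgeGroupC (Ψ k)) (hY : ⁅hodgeGroupC Φ₂, hodgeGroupC Φ₂⁆ = ⊥) :
    hodgeGroupC (prodPeriod (sigmaPiPeriod Ψ) Φ₂) = blockDiagProd (hodgeGroupC (sigmaPiPeriod Ψ)) (hodgeGroupC Φ₂) :=
  hodgeGroupC_prod_eq_blockDiagProd_of_commutator_eq (sigmaPiPeriod Ψ) Φ₂
    (IsRiemannForm.commutator_hodgeGroupC_sigmaPi_eq_self hω h) hY

/-- Real points: `Hg((∏ₖ X_k) × Y)(ℝ) = Hg(∏ₖ X_k)(ℝ) × Hg(Y)(ℝ)`. [cite: Gordon1997, §3 Theorem, proof (p0014 L33–L37)]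
[cite: MoonenZarhin1999LowDim, §3 Theorem (2)] -/
theorem IsRiemannForm.hodgeGroup_sigmaPi_prod_eq_of_commutator_eq (hω : ∀ k, IsRiemannForm (Ψ k) (ω k))
    (h : ∀ k, ⁅hodgeGroupC (Ψ k), hodgeGroupC (Ψ k)⁆ = hodgeGroupC (Ψ k)) (hY : ⁅hodgeGroupC Φ₂, hodgeGroupC Φ₂⁆ = ⊥) :
    hodgeGroup (prodPeriod (sigmaPiPeriod Ψ) Φ₂) =
      ((hodgeGroup (sigmaPiPeriod Ψ)).prod (hodgeGroup Φ₂)).map (blockDiag (Σ k, σ k) ι₂) :=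
  hodgeGroup_prod_eq_of_commutator_eq (sigmaPiPeriod Ψ) Φ₂ (IsRiemannForm.commutator_hodgeGroupC_sigmaPi_eq_self hω h) hY

/-- **`Hg((∏ₖ X_k) × (∏ₗ Z_l))(ℂ) = Hg(∏ₖ X_k)(ℂ) × Hg(∏ₗ Z_l)(ℂ)`** for polarised `X_k` with perfect `Hg(X_k)(ℂ)` and ANY
finite family of tori `Z_l` on the Hodge-circle locus (`Hg(Z_l)(ℝ) = h_l(S¹)`; their product has commutative `Hg`,
g37-#4's `commutator_hodgeGroupC_sigmaPiPeriod_eq_bot_of_coe_eq_range`). [cite: MoonenZarhin1999LowDim, §3 Theorem (2) (p0006 L74–L78)]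
[cite: Gordon1997, §3 Theorem, proof (p0014 L33–L37)] -/
theorem IsRiemannForm.hodgeGroupC_sigmaPi_prod_sigmaPiPeriod_eq_blockDiagProd_of_coe_eq_range
    (hω : ∀ k, IsRiemannForm (Ψ k) (ω k)) (h : ∀ k, ⁅hodgeGroupC (Ψ k), hodgeGroupC (Ψ k)⁆ = hodgeGroupC (Ψ k))
    {κ' : Type*} [Fintype κ'] [DecidableEq κ'] {σ' : κ' → Type*} [∀ l, Fintype (σ' l)] [∀ l, DecidableEq (σ' l)]
    {F' : κ' → Type*} [∀ l, NormedAddCommGroup (F' l)] [∀ l, NormedSpace ℂ (F' l)] (Ψ' : ∀ l, (σ' l → ℝ) ≃L[ℝ] F' l)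
    (hZ : ∀ l, (hodgeGroup (Ψ' l) : Set (SpecialLinearGroup (σ' l) ℝ)) = Set.range (hodgeCircleSL (Ψ' l))) :
    hodgeGroupC (prodPeriod (sigmaPiPeriod Ψ) (sigmaPiPeriod Ψ')) =
      blockDiagProd (hodgeGroupC (sigmaPiPeriod Ψ)) (hodgeGroupC (sigmaPiPeriod Ψ')) :=
  IsRiemannForm.hodgeGroupC_sigmaPi_prod_eq_blockDiagProd_of_commutator_eq (sigmaPiPeriod Ψ') hω h
    (commutator_hodgeGroupC_sigmaPiPeriod_eq_bot_of_coe_eq_range Ψ' hZ)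

/-- **Stable nondegeneracy: `∏ₖ X_k` stably nondegenerate (polarised `X_k`, perfect `Hg(X_k)(ℂ)`) and `Y` stably
nondegenerate with commutative `Hg(Y)(ℂ)` ⟹ `(∏ₖ X_k) × Y` stably nondegenerate** (Hazama's product theorem, g37-#4).
[cite: Gordon1997, Thm. 7.6.2 and p0021 L22–L25] [cite: MoonenZarhin1999LowDim, §3 Theorem (2) and §1] -/
theorem IsRiemannForm.forall_divisorClasses_powPeriod_sigmaPi_prod_eq_hodgeClasses_of_commutator_eq
    (hω : ∀ k, IsRiemannForm (Ψ k) (ω k)) (h : ∀ k, ⁅hodgeGroupC (Ψ k), hodgeGroupC (Ψ k)⁆ = hodgeGroupC (Ψ k))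
    (hY : ⁅hodgeGroupC Φ₂, hodgeGroupC Φ₂⁆ = ⊥)
    (hX : ∀ n p, divisorClasses (powPeriod (sigmaPiPeriod Ψ) n) p = hodgeClasses (powPeriod (sigmaPiPeriod Ψ) n) p)
    (hYs : ∀ n p, divisorClasses (powPeriod Φ₂ n) p = hodgeClasses (powPeriod Φ₂ n) p) :
    ∀ n p, divisorClasses (powPeriod (prodPeriod (sigmaPiPeriod Ψ) Φ₂) n) p =
      hodgeClasses (powPeriod (prodPeriod (sigmaPiPeriod Ψ) Φ₂) n) p :=
  forall_divisorClasses_powPeriod_prod_eq_hodgeClasses_of_commutator_eq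
    (IsRiemannForm.commutator_hodgeGroupC_sigmaPi_eq_self hω h) hY hX hYs

end Gordon

end ComplexTorus

end Literature.Geometry.Kaehler

end
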